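import Summits.AnomalousDissipation.AnomalousDissipation.Theses.VirtualDissipation
import Summits.AnomalousDissipation.AnomalousDissipation.Theorems.LightSteadyStatesGP.Negative.TrivialWitnesses
import Summits.AnomalousDissipation.AnomalousDissipation.Theorems.BaireTransferRobustLoudUpgradeStubCensusInterior
import Literature.Analysis.FluidPDE.SteadyNavierStokesProofs
import Literature.Analysis.FluidPDE.NSCoriolisTorus
import Literature.Analysis.FunctionSpaces.TorusFluidGlueProofs

/-!
# Negative lemmas for crux `LightSteadyStatesGP` (stmt-AnomalousDissipation-15151, route VirtualDissipation) —
# the a-priori (Leray–Temam) regime: which clauses of the crux carry its content (refuter cdisprove, cycle 1)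

The crux: `∃ ν_j ∈ (0,1]`, `ν_j → 0`, classical steady states `(u_j,p_j)` of `NS_{ν_j}(f_GP)` on the unit torus,
`∫ u_j = 0`, `∫|u_j|² ≤ 2`.  Load-bearing analysis of its clauses, as theorems (sorry-free):

* `ceiling` — the a-priori CEILING of every MEAN-ZERO classical steady state of `NS_ν(f_GP)`, `ν > 0`:
  `∫|u|² ≤ 3/(32π⁴ν²)` and `ν‖∇u‖₂² ≤ 3/(8π²ν)` (energy identity `ν‖∇u‖² = ∫⟪f_GP,u⟫`, Cauchy–Schwarz
  `(∫⟪f,u⟫)² ≤ (3/2)∫|u|²`, Poincaré `4π²∫|u|² ≤ ‖∇u‖²`; Temam 1979, Ch. II (1.22)).  This is the ONLY place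
  the mean-zero clause enters an a-priori estimate (Poincaré); it is vacuous as `ν → 0`.
* `exists_light_meanZero_steadyStateGP_of_le` — **light mean-zero classical steady states of `f_GP` exist at every
  viscosity `ν ≥ √3/(8π²) ≈ 0.02194`** (box units `ν_box = (2π)^{3/2}ν ≥ 0.3455`): Temam existence
  (`Torus.exists_mem_energySpaceV_isSteadyWeakSolution`) + regularity/pressure recovery
  (`CensusInterior.exists_isSteadyNSState`) + the ceiling.  So the crux's content is confined to the window
  `0 < ν < √3/(8π²)`.
* `lightSteadyStatesGP_withoutVanishing` — the crux with the clause `ν_j → 0` DROPPED is TRUE (constant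
  sequence `ν_j = 1`): **the vanishing-viscosity clause carries the whole difficulty**.
* `lightSteadyStatesGP_iff_withoutLeOne` — the normalisation `ν_j ≤ 1` is provably redundant (pass to a tail of
  the sequence): the crux is equivalent to its shape with `ν_j ≤ 1` dropped.

Read together with `Negative/LevelFloor.lean` (ν-uniform FLOOR `∫|u|² ≥ 3/(4π) − O(ν)`, no level below `3/(4π)`)
and `Negative/TrivialWitnesses.lean` (no rest state, no laminar `c • f_GP` state): every cheap clause of the crux
is settled; what remains is exactly "a ν-UNIFORM energy bound `≤ 2` for SOME mean-zero steady branch as `ν → 0`",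
for which the only a-priori information is the shell `3/(4π) − O(ν) ≤ ∫|u|² ≤ 3/(32π⁴ν²)`.
-/

set_option linter.dupNamespace false

noncomputable section

open MeasureTheory Set Filter Topology
open scoped InnerProductSpace RealInnerProductSpace

namespace Summit.AnomalousDissipation.AnomalousDissipation.Theorems.LightSteadyStatesGP.Negative.AprioriRegime

open Literature.Analysis.FunctionSpaces Literature.Analysis.FluidPDE
open Summit.AnomalousDissipation.AnomalousDissipation.Theorems.EnsembleRigidity
open Summit.AnomalousDissipation.AnomalousDissipation.Theorems.EnsembleRigidity.GPStatisticalRigidity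
open Summit.AnomalousDissipation.AnomalousDissipation.Theorems.EnsembleRigidity.GPMeanBoundedFamily

/-! ## §1 A-priori identities and inequalities at a classical steady state of `NS_ν(f_GP)` -/

/-- Steady energy identity `ν ‖∇u‖₂² = ∫⟪f_GP, u⟫` (constant kinetic energy;
`Torus.IsClassicalNSSolutionOn.energy_balance_holds`; private copy of `Negative.LevelFloor.energy_identity`,
which is not yet importable from this file). [folklore] -/
private theorem energy_identity {ν : ℝ} {u : UnitAddTorus (Fin 3) → EuclideanSpace ℝ (Fin 3)}
    {p : UnitAddTorus (Fin 3) → ℝ}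
    (h : Torus.IsClassicalNSSolutionOn Set.univ ν (fun _ => gpForce) (fun _ => u) (fun _ => p)) :
    ν * Torus.gradNormSq u = ∫ x, ⟪gpForce x, u x⟫_ℝ := by
  -- pattern from Theorems/CoherentStatesSteadyNegTameOffThinSets.lean (`steady_energy_identity`)
  have hd := Torus.IsClassicalNSSolutionOn.energy_balance_holds h convex_univ (Set.mem_univ (0 : ℝ))
  rw [hasDerivWithinAt_univ] at hd
  have h0 : HasDerivAt (fun _ : ℝ => Torus.kineticEnergy u) (0 : ℝ) (0 : ℝ) := hasDerivAt_const _ _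
  have := h0.unique hd
  linarith

/-- Cauchy–Schwarz for the work, squared: `(∫⟪f_GP, u⟫)² ≤ (3/2) ∫|u|²` for smooth `u`
(discriminant of `t ↦ ∫|t f_GP − u|² ≥ 0`, `∫|f_GP|² = 3/2`; private copy of
`Negative.LevelFloor.work_sq_le`). [folklore] -/
private theorem work_sq_le {u : UnitAddTorus (Fin 3) → EuclideanSpace ℝ (Fin 3)} (hu : Torus.IsSmooth u) :
    (∫ x, ⟪gpForce x, u x⟫_ℝ) ^ 2 ≤ 3 / 2 * ∫ x, ‖u x‖ ^ 2 := by
  have hfs : Torus.IsSmooth gpForce := gpForce_isSmooth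
  have key : ∀ t : ℝ, 2 * t * ∫ x, ⟪gpForce x, u x⟫_ℝ ≤ t ^ 2 * (3 / 2) + ∫ x, ‖u x‖ ^ 2 := by
    intro t
    have hpt : ∀ x, 2 * t * ⟪gpForce x, u x⟫_ℝ ≤ t ^ 2 * ‖gpForce x‖ ^ 2 + ‖u x‖ ^ 2 := by
      intro x
      have h0 : 0 ≤ ‖t • gpForce x - u x‖ ^ 2 := sq_nonneg _
      rw [norm_sub_sq_real, real_inner_smul_left, norm_smul, mul_pow, Real.norm_eq_abs, sq_abs] at h0
      linarith
    have i1 : Integrable (fun x => 2 * t * ⟪gpForce x, u x⟫_ℝ) volume := (hfs.inner hu).integrable.const_mul _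
    have i2 : Integrable (fun x => t ^ 2 * ‖gpForce x‖ ^ 2 + ‖u x‖ ^ 2) volume :=
      (hfs.norm_sq.integrable.const_mul _).add hu.norm_sq.integrable
    have h := integral_mono i1 i2 hpt
    rw [integral_const_mul, integral_add (hfs.norm_sq.integrable.const_mul _) hu.norm_sq.integrable,
      integral_const_mul, StubHeadCoefficients.integral_norm_sq_gpForce] at h
    exact h
  set W := ∫ x, ⟪gpForce x, u x⟫_ℝ with hW
  have h := key (2 * W / 3)
  nlinarith [h]

/-- **A-priori CEILING** (Temam 1979, Ch. II (1.22), written out for `f_GP` on the unit torus): a MEAN-ZERO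
classical steady state of `NS_ν(f_GP)`, `ν > 0`, has `ν‖∇u‖₂² ≤ 3/(8π²ν)` and `∫|u|² ≤ 3/(32π⁴ν²)`.
[cite: Temam1979, Ch. II Thm. 1.2, (1.21)–(1.22)] -/
theorem ceiling {ν : ℝ} (hν : 0 < ν) {u : UnitAddTorus (Fin 3) → EuclideanSpace ℝ (Fin 3)}
    {p : UnitAddTorus (Fin 3) → ℝ}
    (h : Torus.IsClassicalNSSolutionOn Set.univ ν (fun _ => gpForce) (fun _ => u) (fun _ => p))
    (h0 : Torus.HasZeroMean u) :
    ν * Torus.gradNormSq u ≤ 3 / (8 * Real.pi ^ 2 * ν) ∧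
      ∫ x, ‖u x‖ ^ 2 ≤ 3 / (32 * Real.pi ^ 4 * ν ^ 2) := by
  have hu : Torus.IsSmooth u := h.smooth_velocity.isSmooth_slice (Set.mem_univ (0 : ℝ))
  have hE := energy_identity h
  have hW := work_sq_le hu
  have hP : 4 * Real.pi ^ 2 * ∫ x, ‖u x‖ ^ 2 ≤ Torus.gradNormSq u :=
    Torus.integral_norm_sq_le_gradNormSq_of_hasZeroMean hu h0
  have hG : 0 ≤ Torus.gradNormSq u := Torus.gradNormSq_nonneg u
  have hA : 0 ≤ ∫ x, ‖u x‖ ^ 2 := integral_nonneg fun _ => sq_nonneg _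
  have hπ : 0 < Real.pi := Real.pi_pos
  set G := Torus.gradNormSq u with hGdef
  set A := ∫ x, ‖u x‖ ^ 2 with hAdef
  -- `ν²G² = W² ≤ (3/2)A ≤ (3/2)G/(4π²)`, hence `ν²G ≤ 3/(8π²)`
  have h1 : (ν * G) ^ 2 ≤ 3 / 2 * A := by rw [hE]; exact hW
  have h2 : 8 * Real.pi ^ 2 * (ν * G) ^ 2 ≤ 3 * G := by nlinarith
  have hD : ν * G ≤ 3 / (8 * Real.pi ^ 2 * ν) := by
    rw [le_div_iff₀ (by positivity)]
    -- `ν G · 8π²ν = 8π²(νG)²/G · …`: argue via `G = 0` or `G > 0`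
    rcases hG.eq_or_lt with hG0 | hGpos
    · rw [← hG0]; simp
    · have : 8 * Real.pi ^ 2 * ν ^ 2 * G ≤ 3 := by
        have h3 : 8 * Real.pi ^ 2 * ν ^ 2 * G * G ≤ 3 * G := by nlinarith
        exact le_of_mul_le_mul_right (by nlinarith) hGpos
      nlinarith
  refine ⟨hD, ?_⟩
  rw [le_div_iff₀ (by positivity)]
  have h4 : ν * G * (8 * Real.pi ^ 2 * ν) ≤ 3 := (le_div_iff₀ (by positivity)).1 hD
  have h5 := mul_le_mul_of_nonneg_left hP (by positivity : (0 : ℝ) ≤ 8 * Real.pi ^ 2 * ν ^ 2)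
  nlinarith [h4, h5]

/-! ## §2 Light mean-zero steady states exist for every `ν ≥ √3/(8π²)`; the clause `ν_j → 0` is the crux -/

/-- The a-priori light threshold `ν_* = √3/(8π²) ≈ 0.02194`: for `ν ≥ ν_*`, `3/(32π⁴ν²) ≤ 2`. [folklore] -/
theorem ceiling_le_two_of_le {ν : ℝ} (hν : Real.sqrt 3 / (8 * Real.pi ^ 2) ≤ ν) :
    3 / (32 * Real.pi ^ 4 * ν ^ 2) ≤ 2 := by
  have hπ : 0 < Real.pi := Real.pi_pos
  have hs : 0 < Real.sqrt 3 / (8 * Real.pi ^ 2) := by positivity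
  have hν0 : 0 < ν := hs.trans_le hν
  have h1 : 3 / (64 * Real.pi ^ 4) ≤ ν ^ 2 := by
    have h2 : (Real.sqrt 3 / (8 * Real.pi ^ 2)) ^ 2 = 3 / (64 * Real.pi ^ 4) := by
      rw [div_pow, Real.sq_sqrt (by norm_num : (0 : ℝ) ≤ 3)]
      ring
    rw [← h2]
    exact pow_le_pow_left₀ hs.le hν 2
  rw [div_le_iff₀ (by positivity)]
  have h3 : 3 ≤ 64 * Real.pi ^ 4 * ν ^ 2 := by
    have := (div_le_iff₀ (by positivity : (0 : ℝ) < 64 * Real.pi ^ 4)).1 h1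
    linarith
  nlinarith

/-- **Light mean-zero classical steady states of `f_GP` exist at every viscosity `ν ≥ √3/(8π²) ≈ 0.02194`**
(Temam existence in `V` + regularity and pressure recovery + the a-priori ceiling).  Stated with the force
inline, exactly as the crux's steady-state clause. [cite: Temam1979, Ch. II Thm. 1.2 and Prop. 1.1] -/
theorem exists_light_meanZero_steadyStateGP_of_le {ν : ℝ} (hν : Real.sqrt 3 / (8 * Real.pi ^ 2) ≤ ν) :
    ∃ (u : UnitAddTorus (Fin 3) → EuclideanSpace ℝ (Fin 3)) (p : UnitAddTorus (Fin 3) → ℝ),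
      Torus.IsClassicalNSSolutionOn Set.univ ν (fun _ => fun x : UnitAddTorus (Fin 3) => (Literature.Analysis.FluidPDE.Torus.stokesMode (Pi.single (2 : Fin 3) (1 : ℤ)) (EuclideanSpace.single (0 : Fin 3) (1 : ℝ)) false x + Literature.Analysis.FluidPDE.Torus.stokesMode (Pi.single (0 : Fin 3) (1 : ℤ)) (EuclideanSpace.single (1 : Fin 3) (1 : ℝ)) false x + Literature.Analysis.FluidPDE.Torus.stokesMode (Pi.single (1 : Fin 3) (1 : ℤ)) (EuclideanSpace.single (2 : Fin 3) (1 : ℝ)) false x : EuclideanSpace ℝ (Fin 3))) (fun _ => u) (fun _ => p) ∧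
        Torus.HasZeroMean u ∧ ∫ x, ‖u x‖ ^ 2 ≤ 2 := by
  have hs : 0 < Real.sqrt 3 / (8 * Real.pi ^ 2) := by positivity
  have hν0 : 0 < ν := hs.trans_le hν
  obtain ⟨hfs, -, hf0⟩ : Torus.IsSmooth gpForce ∧ Torus.IsDivFree gpForce ∧ Torus.HasZeroMean gpForce :=
    SteadyStatesLoudBounded.GpAdmissible.stub_gpAdmissible
  obtain ⟨U, hV, hU⟩ := Torus.exists_mem_energySpaceV_isSteadyWeakSolution hν0 (hfs.memLp 2)
  obtain ⟨v, p, hst, hv0, -, -⟩ :=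
    RobustLoudUpgrade.CensusInterior.exists_isSteadyNSState hfs hf0 hν0 hV hU
  refine ⟨v, p, hst, hv0, ?_⟩
  exact ((ceiling hν0 hst hv0).2).trans (ceiling_le_two_of_le hν)

/-- **The clause `ν_j → 0` carries the whole difficulty**: the crux with `Tendsto ν atTop (𝓝 0)` DROPPED
(everything else verbatim) is TRUE — witnessed by the constant sequence `ν_j = 1` and one light mean-zero
steady state of `NS₁(f_GP)` (energy `≤ 3/(32π⁴) < 10⁻³`). [folklore] -/
theorem lightSteadyStatesGP_withoutVanishing :
    ∃ (ν : ℕ → ℝ) (u : ℕ → UnitAddTorus (Fin 3) → EuclideanSpace ℝ (Fin 3)) (p : ℕ → UnitAddTorus (Fin 3) → ℝ), (∀ j, 0 < ν j ∧ ν j ≤ 1) ∧ (∀ j, Literature.Analysis.FunctionSpaces.Torus.IsClassicalNSSolutionOn Set.univ (ν j) (fun _ => fun x : UnitAddTorus (Fin 3) => (Literature.Analysis.FluidPDE.Torus.stokesMode (Pi.single (2 : Fin 3) (1 : ℤ)) (EuclideanSpace.single (0 : Fin 3) (1 : ℝ)) false x + Literature.Analysis.FluidPDE.Torus.stokesMode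 (Pi.single (0 : Fin 3) (1 : ℤ)) (EuclideanSpace.single (1 : Fin 3) (1 : ℝ)) false x + Literature.Analysis.FluidPDE.Torus.stokesMode (Pi.single (1 : Fin 3) (1 : ℤ)) (EuclideanSpace.single (2 : Fin 3) (1 : ℝ)) false x : EuclideanSpace ℝ (Fin 3))) (fun _ => u j) (fun _ => p j)) ∧ (∀ j, Literature.Analysis.FunctionSpaces.Torus.HasZeroMean (u j)) ∧ ∀ j, ∫ x, ‖u j x‖ ^ 2 ≤ 2 := by
  have h1 : Real.sqrt 3 / (8 * Real.pi ^ 2) ≤ 1 := by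
    rw [div_le_one (by positivity)]
    have hs : Real.sqrt 3 ≤ 2 := by
      rw [Real.sqrt_le_left (by norm_num)]
      norm_num
    nlinarith [Real.pi_gt_three]
  obtain ⟨u, p, hst, hu0, hE⟩ := exists_light_meanZero_steadyStateGP_of_le h1
  exact ⟨fun _ => 1, fun _ => u, fun _ => p, fun _ => ⟨one_pos, le_rfl⟩, fun _ => hst, fun _ => hu0,
    fun _ => hE⟩

/-! ## §3 The normalisation `ν_j ≤ 1` is redundant -/

/-- **`ν_j ≤ 1` only normalises**: the crux is equivalent to its shape with `ν_j ≤ 1` dropped (along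
`ν_j → 0` a tail of the sequence lies in `(0,1]`; re-index). [folklore] -/
theorem lightSteadyStatesGP_iff_withoutLeOne :
    Summit.AnomalousDissipation.AnomalousDissipation.Theses.VirtualDissipation.LightSteadyStatesGP ↔
      ∃ (ν : ℕ → ℝ) (u : ℕ → UnitAddTorus (Fin 3) → EuclideanSpace ℝ (Fin 3)) (p : ℕ → UnitAddTorus (Fin 3) → ℝ), (∀ j, 0 < ν j) ∧ Filter.Tendsto ν Filter.atTop (nhds 0) ∧ (∀ j, Literature.Analysis.FunctionSpaces.Torus.IsClassicalNSSolutionOn Set.univ (ν j) (fun _ => fun x : UnitAddTorus (Fin 3) => (Literature.Analysis.FluidPDE.Torus.stokesMode (Pi.single (2 : Fin 3) (1 : ℤ)) (EuclideanSpace.single (0 : Fin 3) (1 : ℝ)) false x + Literature.Analysis.FluidPDE.Torus.stokesMode (Pi.single (0 : Fin 3) (1 : ℤ)) (EuclideanSpace.single (1 : Fin 3) (1 : ℝ)) false x + Literature.Analysis.FluidPDE.Torus.stokesMode (Pi.single (1 : Fin 3) (1 : ℤ)) (EuclideanSpace.single (2 : Fin 3) (1 : ℝ)) false x : EuclideanSpace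 ℝ (Fin 3))) (fun _ => u j) (fun _ => p j)) ∧ (∀ j, Literature.Analysis.FunctionSpaces.Torus.HasZeroMean (u j)) ∧ ∀ j, ∫ x, ‖u j x‖ ^ 2 ≤ 2 := by
  constructor
  · rintro ⟨ν, u, p, hν, hν0, hsol, hmean, hE⟩
    exact ⟨ν, u, p, fun j => (hν j).1, hν0, hsol, hmean, hE⟩
  · rintro ⟨ν, u, p, hν, hν0, hsol, hmean, hE⟩
    -- a tail of the sequence lies below 1
    obtain ⟨N, hN⟩ := ((tendsto_order.1 hν0).2 1 one_pos).exists_forall_of_atTop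
    refine ⟨fun j => ν (j + N), fun j => u (j + N), fun j => p (j + N),
      fun j => ⟨hν _, (hN _ (Nat.le_add_left N j)).le⟩, hν0.comp (tendsto_add_atTop_nat N),
      fun j => hsol _, fun j => hmean _, fun j => hE _⟩

end Summit.AnomalousDissipation.AnomalousDissipation.Theorems.LightSteadyStatesGP.Negative.AprioriRegime

end
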